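import Summits.ResolutionOfSingularities.ResolutionOfSingularities.Theorems.WeightedInvariantLocalWeightedDropNCProductRungs
import Summits.ResolutionOfSingularities.ResolutionOfSingularities.Theorems.WeightedInvariantLocalWeightedDropNCArrangements

/-!
# `LocalWeightedDrop`, line `nc-game-transport`: PRODUCT COROLLARIES of the rungs — hyperplane arrangements times plane germs /
# arrangements / any finitely winnable germ, in disjoint blocks of variables

[OURS · L1 W4.3 · chain w43, engine crux `LocalWeightedDrop` stmt-ResolutionOfSingularities-8899; strategist res-L1-w43-strat-1's line
`nc-game-transport`; res-L1-w43-plan-1 DEALS gen 9 #16 (2) → res-type-088.]  One-line combinations of the landed rungs: R2 (hyperplane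
arrangements, `NCArrangement.winsIn_arrangement`, p514936), R5 (product closure over disjoint blocks, `NCTransport.winsIn_germIsNC_mul_disjoint`
/ `winsIn_germIsNC_mul_split`, res-D-pv-006 p516043/p516848), `HTOT 1` (`NCTransport.winsIn_plane`, p515862) and the transport
`NCTransport.won_of_winsIn` (p507842).  The objects are the programme's own games; NOT a statement of any manuscript; closes nothing by name.
These are the census rows «arrangement × plane» / «arrangement × arrangement» / «arrangement × (finitely winnable)» for W4/W5, all
UNCONDITIONAL and in every characteristic:

* `exists_winsIn_arrangement` — R2 in the TOT shape.
* `exists_winsIn_arrangement_mul_of_winsIn` / `won_of_dvd_arrangement_mul_pow` — an arrangement in the left block times ANY finitely winnable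
  germ in the right block (census spelling `xᵢ ↦ xᵢ`, `xⱼ ↦ x_{m₁+1+j}`); `…_split` forms for an arbitrary splitting of the variables.
* `won_of_dvd_arrangement_mul_plane_pow` (+ `_split`) — arrangement × plane curve germ: e.g. `x₀x₁(x₀+x₁) · (x₃² + x₂³)` in five variables,
  or `x₀ · (x₂² + x₁³)`-type germs in three/four variables, are won together with all divisors of their powers.
* `won_of_dvd_arrangement_mul_arrangement_pow` (+ `_split`) — arrangement × arrangement (also an instance of R2 itself; recorded in the
  product spelling for the census).
-/

set_option linter.dupNamespace false -- mandated namespace of this single-conjunct summit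

namespace Summit.ResolutionOfSingularities.ResolutionOfSingularities.Theorems

namespace NCTransport

open MvPowerSeries Literature.AlgebraicGeometry.Resolution TameFourTupleDrop NCArrangement

variable {k : Type} [Field k]

/-! ## R2 in the TOT shape -/

/-- A hyperplane arrangement `u · ∏ ℓ_j` (non-zero forms, `u(0) ≠ 0`) is finitely winnable in the NC count game. [R2, p514936] -/
theorem exists_winsIn_arrangement {m : ℕ} {ι : Type} [DecidableEq ι] (u : MvPowerSeries (Fin (m + 1)) k) (hu : constantCoeff u ≠ 0)
    (s : Finset ι) (a : ι → Fin (m + 1) → k) (ha : ∀ j ∈ s, a j ≠ 0) :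
    ∃ n, WinsIn (m := m) GermIsNC n (u * ∏ j ∈ s, linForm (a j)) :=
  ⟨_, winsIn_arrangement u hu s a ha⟩

/-! ## Arrangement × finitely winnable germ -/

/-- **ARRANGEMENT × (FINITELY WINNABLE GERM)** in disjoint blocks is finitely winnable (census spelling of the blocks). -/
theorem exists_winsIn_arrangement_mul_of_winsIn {m₁ m₂ : ℕ} {ι : Type} [DecidableEq ι] (u : MvPowerSeries (Fin (m₁ + 1)) k)
    (hu : constantCoeff u ≠ 0) (s : Finset ι) (a : ι → Fin (m₁ + 1) → k) (ha : ∀ j ∈ s, a j ≠ 0)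
    {b : MvPowerSeries (Fin (m₂ + 1)) k} (hb : b ≠ 0) (h : ∃ n, WinsIn (m := m₂) GermIsNC n b) :
    ∃ n, WinsIn (m := m₁ + m₂ + 1) GermIsNC n
      (MvPowerSeries.subst (fun i : Fin (m₁ + 1) => (X ⟨i.val, by omega⟩ : MvPowerSeries (Fin (m₁ + m₂ + 1 + 1)) k))
          (u * ∏ j ∈ s, linForm (a j)) *
        MvPowerSeries.subst (fun j : Fin (m₂ + 1) => (X ⟨m₁ + 1 + j.val, by omega⟩ : MvPowerSeries (Fin (m₁ + m₂ + 1 + 1)) k)) b) :=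
  exists_winsIn_germIsNC_mul_disjoint m₁ m₂ (arrangement_ne_zero u hu s a ha) hb (exists_winsIn_arrangement u hu s a ha) h

/-- … hence, in characteristic `p`, every divisor of a power of it is won in the weighted game. -/
theorem won_of_dvd_arrangement_mul_pow (p : ℕ) (hp : p.Prime) [CharP k p] {m₁ m₂ : ℕ} {ι : Type} [DecidableEq ι]
    (u : MvPowerSeries (Fin (m₁ + 1)) k) (hu : constantCoeff u ≠ 0) (s : Finset ι) (a : ι → Fin (m₁ + 1) → k)
    (ha : ∀ j ∈ s, a j ≠ 0) {b : MvPowerSeries (Fin (m₂ + 1)) k} (hb : b ≠ 0) (h : ∃ n, WinsIn (m := m₂) GermIsNC n b) (N : ℕ)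
    (f : MvPowerSeries (Fin (m₁ + m₂ + 1 + 1)) k)
    (hf : f ∣ (MvPowerSeries.subst (fun i : Fin (m₁ + 1) => (X ⟨i.val, by omega⟩ : MvPowerSeries (Fin (m₁ + m₂ + 1 + 1)) k))
          (u * ∏ j ∈ s, linForm (a j)) *
        MvPowerSeries.subst (fun j : Fin (m₂ + 1) => (X ⟨m₁ + 1 + j.val, by omega⟩ : MvPowerSeries (Fin (m₁ + m₂ + 1 + 1)) k)) b) ^
          (N + 1)) :
    CobordantGame.Won k (m₁ + m₂ + 1 + 1) f :=
  won_of_dvd_mul_disjoint_pow p hp m₁ m₂ (arrangement_ne_zero u hu s a ha) hb (exists_winsIn_arrangement u hu s a ha) h N f hf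

/-- The same for an ARBITRARY SPLITTING `e : Fin (m₁+1) ⊕ Fin (m₂+1) ≃ Fin (M+1)` of the variables. -/
theorem won_of_dvd_arrangement_mul_split_pow (p : ℕ) (hp : p.Prime) [CharP k p] {m₁ m₂ M : ℕ}
    (e : Fin (m₁ + 1) ⊕ Fin (m₂ + 1) ≃ Fin (M + 1)) {ι : Type} [DecidableEq ι] (u : MvPowerSeries (Fin (m₁ + 1)) k)
    (hu : constantCoeff u ≠ 0) (s : Finset ι) (a : ι → Fin (m₁ + 1) → k) (ha : ∀ j ∈ s, a j ≠ 0)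
    {b : MvPowerSeries (Fin (m₂ + 1)) k} (hb : b ≠ 0) (h : ∃ n, WinsIn (m := m₂) GermIsNC n b) (N : ℕ)
    (f : MvPowerSeries (Fin (M + 1)) k)
    (hf : f ∣ (rename (fun i => e (Sum.inl i)) (u * ∏ j ∈ s, linForm (a j)) * rename (fun j => e (Sum.inr j)) b) ^ (N + 1)) :
    CobordantGame.Won k (M + 1) f :=
  won_of_dvd_mul_split_pow p hp e (arrangement_ne_zero u hu s a ha) hb (exists_winsIn_arrangement u hu s a ha) h N f hf

/-! ## Arrangement × plane curve germ -/

/-- **ARRANGEMENT × PLANE CURVE GERM** (disjoint blocks; every field): finitely winnable in the NC count game. -/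
theorem exists_winsIn_arrangement_mul_plane {m₁ : ℕ} {ι : Type} [DecidableEq ι] (u : MvPowerSeries (Fin (m₁ + 1)) k)
    (hu : constantCoeff u ≠ 0) (s : Finset ι) (a : ι → Fin (m₁ + 1) → k) (ha : ∀ j ∈ s, a j ≠ 0)
    (b : MvPowerSeries (Fin 2) k) (hb : b ≠ 0) :
    ∃ n, WinsIn (m := m₁ + 1 + 1) GermIsNC n
      (MvPowerSeries.subst (fun i : Fin (m₁ + 1) => (X ⟨i.val, by omega⟩ : MvPowerSeries (Fin (m₁ + 1 + 1 + 1)) k))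
          (u * ∏ j ∈ s, linForm (a j)) *
        MvPowerSeries.subst (fun j : Fin 2 => (X ⟨m₁ + 1 + j.val, by omega⟩ : MvPowerSeries (Fin (m₁ + 1 + 1 + 1)) k)) b) :=
  exists_winsIn_arrangement_mul_of_winsIn u hu s a ha hb (winsIn_plane k b hb)

/-- **… IN THE WEIGHTED GAME**: in characteristic `p`, every divisor of a power of (arrangement in `x₀..x_{m₁}`) · (plane germ in
`x_{m₁+1}, x_{m₁+2}`) is won in `CobordantGame.Won k (m₁ + 3)` — e.g. `x₀x₁(x₀+x₁)·(x₃²+x₂³)`, unconditionally. -/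
theorem won_of_dvd_arrangement_mul_plane_pow (p : ℕ) (hp : p.Prime) [CharP k p] {m₁ : ℕ} {ι : Type} [DecidableEq ι]
    (u : MvPowerSeries (Fin (m₁ + 1)) k) (hu : constantCoeff u ≠ 0) (s : Finset ι) (a : ι → Fin (m₁ + 1) → k)
    (ha : ∀ j ∈ s, a j ≠ 0) (b : MvPowerSeries (Fin 2) k) (hb : b ≠ 0) (N : ℕ) (f : MvPowerSeries (Fin (m₁ + 1 + 1 + 1)) k)
    (hf : f ∣ (MvPowerSeries.subst (fun i : Fin (m₁ + 1) => (X ⟨i.val, by omega⟩ : MvPowerSeries (Fin (m₁ + 1 + 1 + 1)) k))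
          (u * ∏ j ∈ s, linForm (a j)) *
        MvPowerSeries.subst (fun j : Fin 2 => (X ⟨m₁ + 1 + j.val, by omega⟩ : MvPowerSeries (Fin (m₁ + 1 + 1 + 1)) k)) b) ^ (N + 1)) :
    CobordantGame.Won k (m₁ + 1 + 1 + 1) f :=
  won_of_dvd_arrangement_mul_pow p hp u hu s a ha hb (winsIn_plane k b hb) N f hf

/-- Arrangement × plane germ for an arbitrary splitting `Fin (m₁+1) ⊕ Fin 2 ≃ Fin (M+1)`. -/
theorem won_of_dvd_arrangement_mul_plane_split_pow (p : ℕ) (hp : p.Prime) [CharP k p] {m₁ M : ℕ}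
    (e : Fin (m₁ + 1) ⊕ Fin 2 ≃ Fin (M + 1)) {ι : Type} [DecidableEq ι] (u : MvPowerSeries (Fin (m₁ + 1)) k)
    (hu : constantCoeff u ≠ 0) (s : Finset ι) (a : ι → Fin (m₁ + 1) → k) (ha : ∀ j ∈ s, a j ≠ 0)
    (b : MvPowerSeries (Fin 2) k) (hb : b ≠ 0) (N : ℕ) (f : MvPowerSeries (Fin (M + 1)) k)
    (hf : f ∣ (rename (fun i => e (Sum.inl i)) (u * ∏ j ∈ s, linForm (a j)) * rename (fun j => e (Sum.inr j)) b) ^ (N + 1)) :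
    CobordantGame.Won k (M + 1) f :=
  won_of_dvd_arrangement_mul_split_pow p hp e u hu s a ha hb (winsIn_plane k b hb) N f hf

/-! ## Arrangement × arrangement -/

/-- **ARRANGEMENT × ARRANGEMENT** in disjoint blocks (also an arrangement — R2 covers it directly; recorded in the product spelling): every
divisor of a power is won in the weighted game, every prime characteristic. -/
theorem won_of_dvd_arrangement_mul_arrangement_pow (p : ℕ) (hp : p.Prime) [CharP k p] {m₁ m₂ : ℕ} {ι ι' : Type} [DecidableEq ι]
    [DecidableEq ι'] (u : MvPowerSeries (Fin (m₁ + 1)) k) (hu : constantCoeff u ≠ 0) (s : Finset ι) (a : ι → Fin (m₁ + 1) → k)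
    (ha : ∀ j ∈ s, a j ≠ 0) (u' : MvPowerSeries (Fin (m₂ + 1)) k) (hu' : constantCoeff u' ≠ 0) (s' : Finset ι')
    (a' : ι' → Fin (m₂ + 1) → k) (ha' : ∀ j ∈ s', a' j ≠ 0) (N : ℕ) (f : MvPowerSeries (Fin (m₁ + m₂ + 1 + 1)) k)
    (hf : f ∣ (MvPowerSeries.subst (fun i : Fin (m₁ + 1) => (X ⟨i.val, by omega⟩ : MvPowerSeries (Fin (m₁ + m₂ + 1 + 1)) k))
          (u * ∏ j ∈ s, linForm (a j)) *
        MvPowerSeries.subst (fun j : Fin (m₂ + 1) => (X ⟨m₁ + 1 + j.val, by omega⟩ : MvPowerSeries (Fin (m₁ + m₂ + 1 + 1)) k))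
          (u' * ∏ j ∈ s', linForm (a' j))) ^ (N + 1)) :
    CobordantGame.Won k (m₁ + m₂ + 1 + 1) f :=
  won_of_dvd_arrangement_mul_pow p hp u hu s a ha (arrangement_ne_zero u' hu' s' a' ha') (exists_winsIn_arrangement u' hu' s' a' ha') N f hf

/-- Arrangement × arrangement for an arbitrary splitting of the variables. -/
theorem won_of_dvd_arrangement_mul_arrangement_split_pow (p : ℕ) (hp : p.Prime) [CharP k p] {m₁ m₂ M : ℕ}
    (e : Fin (m₁ + 1) ⊕ Fin (m₂ + 1) ≃ Fin (M + 1)) {ι ι' : Type} [DecidableEq ι] [DecidableEq ι']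
    (u : MvPowerSeries (Fin (m₁ + 1)) k) (hu : constantCoeff u ≠ 0) (s : Finset ι) (a : ι → Fin (m₁ + 1) → k)
    (ha : ∀ j ∈ s, a j ≠ 0) (u' : MvPowerSeries (Fin (m₂ + 1)) k) (hu' : constantCoeff u' ≠ 0) (s' : Finset ι')
    (a' : ι' → Fin (m₂ + 1) → k) (ha' : ∀ j ∈ s', a' j ≠ 0) (N : ℕ) (f : MvPowerSeries (Fin (M + 1)) k)
    (hf : f ∣ (rename (fun i => e (Sum.inl i)) (u * ∏ j ∈ s, linForm (a j)) *
        rename (fun j => e (Sum.inr j)) (u' * ∏ j ∈ s', linForm (a' j))) ^ (N + 1)) :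
    CobordantGame.Won k (M + 1) f :=
  won_of_dvd_arrangement_mul_split_pow p hp e u hu s a ha (arrangement_ne_zero u' hu' s' a' ha')
    (exists_winsIn_arrangement u' hu' s' a' ha') N f hf

end NCTransport

end Summit.ResolutionOfSingularities.ResolutionOfSingularities.Theorems
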